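import Summits.BirchSwinnertonDyer.BirchSwinnertonDyer.Theorems.ByReductionTypeAtTwoRankOneSigmaHeightLevelShift
import Summits.BirchSwinnertonDyer.BirchSwinnertonDyer.Theorems.ByReductionTypeAtTwoRankOneSigmaHeightTateFormula
import Literature.NumberTheory.EllipticCurves.CanonicalPAdicHeightLocalIndexProofs
import Literature.NumberTheory.EllipticCurves.CanonicalPAdicHeightParallelogramProofs
import HarnessLib

/-!
# Route `ByReductionTypeAtTwo`, crux `RankOneAtTwoBigImageOddLocal` (item stmt-BirchSwinnertonDyer-23715), line AN62, σ₀-LEMMA BLOCK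
# (cell `bsd-f1-sign2`, planner seat `-an` g50; `--supports 23715`, helper):
# **THE EFFECTIVE TATE FORMULA WITH AN EXPLICIT GEOMETRIC RATE: `‖⟨Q,Q⟩_D − 4⁻ᵏ·log₂ num x(2ᵏQ)‖₂ ≤ 2·4⁻ᵏ·‖x(Q)‖₂⁻²`**

HONEST FRAMING (D-0036/D-0054): THEOREMS ONLY (no definition, no named fact, no `sorry`, no instance).  `V/ℚ` `ℤ`-integral with `a₁ = 0`,
`D` any `PAdicHeightData V 2` given on the local-conditions locus by the σ-formula of a normalised solution `Sq` of the σ²-ODE (the binders of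
`…SigmaHeightTateFormula`), `Q = (x, y)` with `‖x‖₂ ≥ 4` and non-singular reduction at every prime.  Then for every `k ≥ 1` the multiple
`2ᵏQ = (x′, y′)` is affine (`exists_two_pow_nsmul_eq_some`), lies in the local-conditions locus at `2` (`satisfiesLocalConditions_two_pow_nsmul`:
`‖x′‖₂ = 4ᵏ‖x‖₂ ≥ 16` by the exact level shift `norm_x_two_pow_nsmul_eq`, `z(2ᵏQ)` in the σ-disc, `E₀` a subgroup), and the effective Tate
formula of `…SigmaHeightTateFormula` becomes the EXPLICIT-RATE statement `‖⟨Q,Q⟩_D − (4ᵏ)⁻¹·log₂ num x(2ᵏQ)‖₂ ≤ 2·(4ᵏ)⁻¹·‖x‖₂⁻²`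
(`norm_pairing_sub_inv_mul_padicLog_num_le_rate`): `k` doublings compute the σ-height pairing to `2k + 2·lev(Q) − 1` bits.  Nothing here is
a statement about `BSDp`; item 23715 stays OPEN; BSD is proved for no curve.  References: [cite: SilvermanAEC2009, IV.3.2, VII.2, VIII.9]
[cite: MazurSteinTate2006, §1].
-/

set_option autoImplicit false

noncomputable section

open scoped Classical

open WeierstrassCurve PowerSeries Literature Literature.NumberTheory.EllipticCurves

namespace Summit.BirchSwinnertonDyer.BirchSwinnertonDyer.Theorems

namespace NaiveSigmaLogAtTwo

/-- `2ᵏQ` is affine for `‖x(Q)‖₂ ≥ 4` (`a₁ = 0`): no multiple `2ʲQ` is `2`-torsion. [cite: SilvermanAEC2009, IV.3.2, VII.2.2] -/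
theorem exists_two_pow_nsmul_eq_some (V : WeierstrassCurve ℚ) [V.IsIntegral ℤ] (ha1 : V.a₁ = 0) {x y : ℚ}
    (h : V.toAffine.Nonsingular x y) (hx : (4 : ℝ) ≤ ‖(x : ℚ_[2])‖) (k : ℕ) :
    ∃ (x' y' : ℚ) (h' : V.toAffine.Nonsingular x' y'), (2 ^ k : ℕ) • (.some x y h : V.toAffine.Point) = .some x' y' h' := by
  induction k with
  | zero => exact ⟨x, y, h, by simp⟩
  | succ k ih =>
    obtain ⟨xk, yk, hk', hk⟩ := ih
    have hxk : (4 : ℝ) ≤ ‖(xk : ℚ_[2])‖ := by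
      rw [norm_x_two_pow_nsmul_eq V ha1 h hx k hk' hk]
      have : (1 : ℝ) ≤ 4 ^ k := one_le_pow₀ (by norm_num)
      nlinarith
    have hy := Y_ne_negY_of_four_le V ha1 hk' hxk
    have h' : V.toAffine.Nonsingular (V.toAffine.addX xk xk (V.toAffine.slope xk xk yk yk))
        (V.toAffine.addY xk xk yk (V.toAffine.slope xk xk yk yk)) :=
      WeierstrassCurve.Affine.nonsingular_add hk' hk' fun hxy => hy hxy.right
    refine ⟨_, _, h', ?_⟩
    have hmul : (2 ^ (k + 1) : ℕ) • (.some x y h : V.toAffine.Point) = (2 : ℕ) • ((2 ^ k : ℕ) • (.some x y h : V.toAffine.Point)) := by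
      rw [← mul_nsmul', ← pow_succ']
    rw [hmul, hk, two_nsmul]
    exact WeierstrassCurve.Affine.Point.add_self_of_Y_ne hy

/-- `2ᵏQ` (`k ≥ 1`) satisfies the local conditions at `2` when `‖x(Q)‖₂ ≥ 4`, `a₁ = 0` and `Q` has non-singular reduction everywhere:
`‖x(2ᵏQ)‖₂ = 4ᵏ‖x(Q)‖₂ ≥ 16`, `z(2ᵏQ)` lies in the σ-disc, and `E₀(ℚ) at ℓ` is a subgroup. [cite: SilvermanAEC2009, IV.3.2, VII.2.1] -/
theorem satisfiesLocalConditions_two_pow_nsmul (V : WeierstrassCurve ℚ) [V.IsIntegral ℤ] (ha1 : V.a₁ = 0) {x y : ℚ}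
    (h : V.toAffine.Nonsingular x y) (hx : (4 : ℝ) ≤ ‖(x : ℚ_[2])‖)
    (hns : ∀ ℓ : ℕ, ℓ.Prime → V.HasNonsingularReductionAt ℓ x y) (k : ℕ) (hk1 : 1 ≤ k) {x' y' : ℚ}
    (h' : V.toAffine.Nonsingular x' y') (hk : (2 ^ k : ℕ) • (.some x y h : V.toAffine.Point) = .some x' y' h') :
    V.SatisfiesLocalConditions 2 (.some x' y' h') := by
  have hx' := norm_x_two_pow_nsmul_eq V ha1 h hx k h' hk
  have h16R : (16 : ℝ) ≤ ‖(x' : ℚ_[2])‖ := by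
    rw [hx']
    have : (4 : ℝ) ≤ 4 ^ k := by
      calc (4 : ℝ) = 4 ^ 1 := by norm_num
        _ ≤ 4 ^ k := pow_le_pow_right₀ (by norm_num) hk1
    nlinarith
  have h16 : 16 ≤ padicNorm 2 x' := by
    rw [Padic.eq_padicNorm] at h16R; exact_mod_cast h16R
  dsimp only [WeierstrassCurve.SatisfiesLocalConditions]
  refine ⟨by linarith, inSigmaDisc_two_of_le (W := V) h' h16, fun ℓ hℓ => ?_⟩
  haveI : Fact ℓ.Prime := ⟨hℓ⟩
  have hP : (.some x y h : V.toAffine.Point) ∈ V.nonsingularReductionSubgroupAt ℓ :=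
    (mem_nonsingularReductionSubgroupAt_iff _).mpr ((V.reducesNonsingularlyAt_some ℓ h).mpr (hns ℓ hℓ))
  have h2P := (V.nonsingularReductionSubgroupAt ℓ).nsmul_mem hP (2 ^ k)
  rw [hk, mem_nonsingularReductionSubgroupAt_iff, reducesNonsingularlyAt_some] at h2P
  exact h2P

/-- **THE EFFECTIVE TATE FORMULA WITH EXPLICIT RATE (kernel)**: `‖⟨Q,Q⟩_D − (4ᵏ)⁻¹·log₂ num x(2ᵏQ)‖₂ ≤ 2·(4ᵏ)⁻¹·‖x(Q)‖₂⁻²` for every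
`k ≥ 1`, `Q = (x, y)` with `‖x‖₂ ≥ 4`, `a₁ = 0`, non-singular reduction everywhere — `k` doublings give the σ-height pairing to
`2k + 2·log₄‖x‖₂ − 1` bits. [cite: SilvermanAEC2009, VIII.9] [cite: MazurSteinTate2006, §1] -/
theorem norm_pairing_sub_inv_mul_padicLog_num_le_rate (V : WeierstrassCurve ℚ) [V.IsIntegral ℤ] (ha1 : V.a₁ = 0) (Sq : ℚ_[2]⟦X⟧)
    (h0 : constantCoeff Sq = 0) (h1 : coeff 1 Sq = 0) (h2 : coeff 2 Sq = 1) (h3 : coeff 3 Sq = 0)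
    (hODE : (V.baseChange ℚ_[2]).SatisfiesSigmaSqODE Sq 0) (D : PAdicHeightData V 2)
    (hD : ∀ {x y : ℚ} (h : V.toAffine.Nonsingular x y), V.SatisfiesLocalConditions 2 (.some x y h) →
      D.pairing (.some x y h) (.some x y h) = padicLog 2 ((x.den : ℚ) : ℚ_[2]) - padicLog 2 (padicEval Sq (-(x : ℚ_[2]) / y)))
    {x y : ℚ} (h : V.toAffine.Nonsingular x y) (hx : (4 : ℝ) ≤ ‖(x : ℚ_[2])‖)
    (hns : ∀ ℓ : ℕ, ℓ.Prime → V.HasNonsingularReductionAt ℓ x y) (k : ℕ) (hk1 : 1 ≤ k) {x' y' : ℚ}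
    (h' : V.toAffine.Nonsingular x' y') (hk : (2 ^ k : ℕ) • (.some x y h : V.toAffine.Point) = .some x' y' h') :
    ‖D.pairing (.some x y h) (.some x y h) - ((4 : ℚ_[2]) ^ k)⁻¹ * padicLog 2 (x'.num : ℚ_[2])‖
      ≤ 2 * ((4 : ℝ) ^ k)⁻¹ * ‖(x : ℚ_[2])‖⁻¹ ^ 2 := by
  have hQ := satisfiesLocalConditions_two_pow_nsmul V ha1 h hx hns k hk1 h' hk
  have hT := norm_pairing_sub_inv_mul_padicLog_num_le V ha1 Sq h0 h1 h2 h3 hODE D hD (.some x y h) k h' hk hQ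
  have hx' := norm_x_two_pow_nsmul_eq V ha1 h hx k h' hk
  have hX0 : (0 : ℝ) < ‖(x : ℚ_[2])‖ := by linarith
  have h40 : (0 : ℝ) < 4 ^ k := by positivity
  rw [hx'] at hT
  convert hT using 1
  field_simp

/-- The same bound in the form `‖4ᵏ·⟨Q,Q⟩_D − log₂ num x(2ᵏQ)‖₂ ≤ 2·(16ᵏ)⁻¹·‖x‖₂⁻²` (`‖4ᵏ‖₂ = 4⁻ᵏ`): the numerators of the Tate tower
determine `4ᵏ⟨Q,Q⟩` to within `2⁻⁴ᵏ⁻²ˡᵉᵛ⁺¹`. [cite: SilvermanAEC2009, VIII.9] -/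
theorem norm_pow_mul_pairing_sub_padicLog_num_le (V : WeierstrassCurve ℚ) [V.IsIntegral ℤ] (ha1 : V.a₁ = 0) (Sq : ℚ_[2]⟦X⟧)
    (h0 : constantCoeff Sq = 0) (h1 : coeff 1 Sq = 0) (h2 : coeff 2 Sq = 1) (h3 : coeff 3 Sq = 0)
    (hODE : (V.baseChange ℚ_[2]).SatisfiesSigmaSqODE Sq 0) (D : PAdicHeightData V 2)
    (hD : ∀ {x y : ℚ} (h : V.toAffine.Nonsingular x y), V.SatisfiesLocalConditions 2 (.some x y h) →
      D.pairing (.some x y h) (.some x y h) = padicLog 2 ((x.den : ℚ) : ℚ_[2]) - padicLog 2 (padicEval Sq (-(x : ℚ_[2]) / y)))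
    {x y : ℚ} (h : V.toAffine.Nonsingular x y) (hx : (4 : ℝ) ≤ ‖(x : ℚ_[2])‖)
    (hns : ∀ ℓ : ℕ, ℓ.Prime → V.HasNonsingularReductionAt ℓ x y) (k : ℕ) (hk1 : 1 ≤ k) {x' y' : ℚ}
    (h' : V.toAffine.Nonsingular x' y') (hk : (2 ^ k : ℕ) • (.some x y h : V.toAffine.Point) = .some x' y' h') :
    ‖(4 : ℚ_[2]) ^ k * D.pairing (.some x y h) (.some x y h) - padicLog 2 (x'.num : ℚ_[2])‖
      ≤ 2 * ((16 : ℝ) ^ k)⁻¹ * ‖(x : ℚ_[2])‖⁻¹ ^ 2 := by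
  have hr := norm_pairing_sub_inv_mul_padicLog_num_le_rate V ha1 Sq h0 h1 h2 h3 hODE D hD h hx hns k hk1 h' hk
  have h4 : ((4 : ℚ_[2]) ^ k) ≠ 0 := pow_ne_zero k (by norm_num)
  have hn4 : ‖(4 : ℚ_[2]) ^ k‖ = ((4 : ℝ) ^ k)⁻¹ := by
    rw [norm_pow, ← inv_pow]
    congr 1
    have h2 : ‖(2 : ℚ_[2])‖ = 2⁻¹ := by
      have := Padic.norm_p (p := 2); exact_mod_cast this
    rw [show (4 : ℚ_[2]) = 2 * 2 by norm_num, norm_mul, h2]; norm_num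
  have e : (4 : ℚ_[2]) ^ k * D.pairing (.some x y h) (.some x y h) - padicLog 2 (x'.num : ℚ_[2]) =
      (4 : ℚ_[2]) ^ k * (D.pairing (.some x y h) (.some x y h) - ((4 : ℚ_[2]) ^ k)⁻¹ * padicLog 2 (x'.num : ℚ_[2])) := by
    field_simp
  rw [e, norm_mul, hn4]
  have h40 : (0 : ℝ) < 4 ^ k := by positivity
  calc ((4 : ℝ) ^ k)⁻¹ * ‖D.pairing (.some x y h) (.some x y h) - ((4 : ℚ_[2]) ^ k)⁻¹ * padicLog 2 (x'.num : ℚ_[2])‖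
      ≤ ((4 : ℝ) ^ k)⁻¹ * (2 * ((4 : ℝ) ^ k)⁻¹ * ‖(x : ℚ_[2])‖⁻¹ ^ 2) := by gcongr
    _ = 2 * ((16 : ℝ) ^ k)⁻¹ * ‖(x : ℚ_[2])‖⁻¹ ^ 2 := by
      rw [show (16 : ℝ) = 4 * 4 by norm_num, mul_pow]; field_simp

end NaiveSigmaLogAtTwo

end Summit.BirchSwinnertonDyer.BirchSwinnertonDyer.Theorems
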